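import Summits.HodgeConjecture.HodgeConjecture.Theses.LimitExtension
import Literature.AlgebraicGeometry.HodgeTheory.MiddleDimensionReductionHolds

/-!
# Route LimitExtension — `Assembly` (item stmt-HodgeConjecture-10868): the glue, modulo its two registered deps, and its exact logical status

The assembly item of route `LimitExtension` is
`Assembly := HodgeModels (inline) → LimitExtensionMid → HypersurfaceHodge → HodgeConjecture`.
The planner's proof is the composition `fun m a b ↦ h₈ m (h₇ a b)` of the two typed glue lemmas
`h₇ : PullbackGlue` (stmt-HodgeConjecture-2999, itself `SpecialisationOfAlgebraicity → PullbackGlue`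
with the specialisation lemma stmt-HodgeConjecture-2998 — proved in the tree as
`limitExtension_pullbackGlue_of_specialisation`) and `h₈ : MiddleDivisorSupportSuffices`
(stmt-HodgeConjecture-10865, the Thomas 2005 Prop. 2 / de Cataldo–Migliorini 2009 §4 induction on
the dimension).  Both are registered statement items of this route and both are OPEN; the item is
therefore not propositional on its own — its unconditional proof is exactly the conjunction of the
proofs of stmt-HodgeConjecture-2998 and stmt-HodgeConjecture-10865.  This file records, sorry-free and
with no named fact in its cone:

* the models antecedent `HodgeModels` (stmt-HodgeConjecture-3050) is a THEOREM of the tree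
  (`nonempty_hodgeModel_holds`: Serre GAGA + de Rham + the Hodge decomposition; recorded against
  the route decl as `limitExtension_hodgeModels_proof` in the sibling file
  `LimitExtensionHodgeModels`, not imported here only to keep this file's import closure to the
  thesis file + Literature), so it is discharged inline wherever `Assembly` or
  `MiddleDivisorSupportSuffices` asks for it;
* `limitExtension_assembly_of` — `PullbackGlue → MiddleDivisorSupportSuffices → Assembly` (the
  planner's composition, verbatim; fed with `limitExtension_pullbackGlue_of_specialisation` of the
  sibling file `LimitExtensionHypersurfacesSufficeOfLE`, which proves
  `SpecialisationOfAlgebraicity → PullbackGlue`, this is the item modulo its two honest gaps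
  stmt-HodgeConjecture-2998 and stmt-HodgeConjecture-10865), and its sharpening
  `limitExtension_assembly_of_pullbackGlue_of_middle` (only the middle-degree form of the second gap
  is needed, below);
* `limitExtension_assembly_iff` — `Assembly ↔ (LimitExtensionMid → HypersurfaceHodge → HodgeConjecture)`
  (the models antecedent discharged);
* `limitExtension_assembly_iff_middle` — by BFNP 2009 Lemma 48, PROVED in the tree
  (`middleDimensionReduction_holds`), the conclusion may be replaced by its middle-dimensional case:
  `Assembly ↔ (LimitExtensionMid → HypersurfaceHodge → every rational middle (m,m)-class on every
  smooth projective 2m-fold is algebraic)`; likewise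
  `limitExtension_middleDivisorSupportSuffices_iff` —
  `MiddleDivisorSupportSuffices ↔ (MiddleDivisorSupport → the same middle-dimensional statement)`:
  of Thomas's three-way induction only the step at and below the middle (divisor descent + Lefschetz
  pencils) is still owed by stmt-HodgeConjecture-10865, the above-middle range being BFNP;
* `limitExtension_hypersurfaceHodge_of_hodgeConjecture`, `limitExtension_not_assembly_iff` —
  `HC → HypersurfaceHodge` (and `HC → Assembly`, trivially: the frame weakens the summit), and
  `¬ Assembly ↔ LimitExtensionMid ∧ HypersurfaceHodge ∧ ¬ HodgeConjecture`: a refutation of the item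
  would have to PROVE both cruxes (two open problems) and refute the Clay problem, so the item is
  settled in neither direction short of its two deps (or of `HodgeConjecture` itself).

Nothing here asserts a Theses decl unconditionally; prover seat
prover-pitem-stmt-HodgeConjecture-10868-0, 2026-08-16.
-/

-- `Summit.HodgeConjecture.HodgeConjecture.Theorems` is the mandated namespace (single-problem summit:
-- Problem = Summit), which `linter.dupNamespace` flags on every declaration; the lakefile turns the
-- linter off for the Summits library (weak option), restated here so stand-alone elaboration is warning-free.
set_option linter.dupNamespace false

noncomputable section

namespace Summit.HodgeConjecture.HodgeConjecture.Theorems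

open Summit.HodgeConjecture.HodgeConjecture.Theses.LimitExtension
open Literature.AlgebraicGeometry Literature.AlgebraicGeometry.HodgeTheory
  Literature.AlgebraicGeometry.Motives CategoryTheory

/-- **`PullbackGlue → MiddleDivisorSupportSuffices → Assembly`** — the planner's composition for
item stmt-HodgeConjecture-10868 ([deps: PullbackGlue, MiddleDivisorSupportSuffices, HodgeModels]):
given Hodge models `m`, the limit extension `a` and the Hodge conjecture on smooth hypersurfaces
`b`, `PullbackGlue` yields `MiddleDivisorSupport` and `MiddleDivisorSupportSuffices m` turns it into
`HodgeConjecture`. [cite: Thomas2005Nodes, Prop. 2] -/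
theorem limitExtension_assembly_of (h₇ : PullbackGlue) (h₈ : MiddleDivisorSupportSuffices) :
    Assembly :=
  fun m a b ↦ h₈ m (h₇ a b)

/-- The models antecedent being a theorem, the item is literally "limit extension of middle Hodge
classes + HC on smooth hypersurfaces ⟹ HC". [cite: Deligne2000, §1] -/
theorem limitExtension_assembly_iff :
    Assembly ↔ (LimitExtensionMid → HypersurfaceHodge → _root_.HodgeConjecture) :=
  ⟨fun h a b ↦ h (fun _ _ hX ↦ nonempty_hodgeModel_holds hX) a b, fun h _ a b ↦ h a b⟩

/-- `HodgeConjecture → HypersurfaceHodge`: the second antecedent of the item is a special case of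
its conclusion (a smooth hypersurface is smooth projective: first conjunct of
`IsSmoothHypersurface`). [cite: Deligne2000, §1] -/
theorem limitExtension_hypersurfaceHodge_of_hodgeConjecture (h : _root_.HodgeConjecture) :
    HypersurfaceHodge :=
  fun _ _ _ hX ↦ h hX.1

/-- **What a refutation of the item would take**: `¬ Assembly ↔ LimitExtensionMid ∧
HypersurfaceHodge ∧ ¬ HodgeConjecture` — one would have to PROVE the limit-extension crux and the
Hodge conjecture for all smooth hypersurfaces, and refute the Clay problem. [folklore] -/
theorem limitExtension_not_assembly_iff :
    ¬ Assembly ↔ LimitExtensionMid ∧ HypersurfaceHodge ∧ ¬ _root_.HodgeConjecture := by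
  rw [limitExtension_assembly_iff]
  constructor
  · intro h
    by_contra h'
    exact h fun a b ↦ Classical.by_contradiction fun hc ↦ h' ⟨a, b, hc⟩
  · rintro ⟨a, b, hc⟩ h
    exact hc (h a b)

/-- **`MiddleDivisorSupportSuffices` needs only the middle degree** (BFNP 2009 Lemma 48, proved in
the tree as `middleDimensionReduction_holds`; Hodge models by `nonempty_hodgeModel_holds`):
`MiddleDivisorSupportSuffices ↔ (MiddleDivisorSupport → every rational (m,m)-class in the middle
degree of every smooth projective 2m-fold is algebraic)`.  Of Thomas's induction (hyperplane
sections above the middle, Lefschetz pencils below it, divisor descent in the middle) the range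
above the middle is thus already supplied; what item stmt-HodgeConjecture-10865 still owes is the
passage `N¹`-supported middle Hodge class ⟶ algebraic (descent to the resolved divisor, Deligne
Hodge III 8.2.8, and HC one below the middle on odd-dimensional varieties — the pencil step).
[cite: BrosnanFangNiePearlstein2009, §6 Lemma 48] [cite: Thomas2005Nodes, Prop. 2] -/
theorem limitExtension_middleDivisorSupportSuffices_iff :
    MiddleDivisorSupportSuffices ↔ (MiddleDivisorSupport →
      ∀ ⦃m : ℕ⦄ ⦃X : SchemeOver ℂ⦄, IsSmoothProjective (2 * m) X →
        ∀ c : complexBetti X (2 * m), IsRationalClass c → IsOfHodgeType (2 * m) X (2 * m) m m c →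
          c ∈ algebraicClasses X m) := by
  constructor
  · intro h hN m X hX c hc hmm
    exact (h (fun _ _ hY ↦ nonempty_hodgeModel_holds hY) hN hX).2 m c hc hmm
  · intro h _ hN n X hX
    exact hodgeConjectureFor_of_middleDimension_holds (h hN) hX

/-- **The item needs only the middle degree**: by BFNP 2009 Lemma 48 (`middleDimensionReduction_holds`)
and `nonempty_hodgeModel_holds`,
`Assembly ↔ (LimitExtensionMid → HypersurfaceHodge → every rational (m,m)-class in the middle degree
of every smooth projective 2m-fold is algebraic)`. [cite: BrosnanFangNiePearlstein2009, §6 Lemma 48] -/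
theorem limitExtension_assembly_iff_middle :
    Assembly ↔ (LimitExtensionMid → HypersurfaceHodge →
      ∀ ⦃m : ℕ⦄ ⦃X : SchemeOver ℂ⦄, IsSmoothProjective (2 * m) X →
        ∀ c : complexBetti X (2 * m), IsRationalClass c → IsOfHodgeType (2 * m) X (2 * m) m m c →
          c ∈ algebraicClasses X m) := by
  rw [limitExtension_assembly_iff]
  constructor
  · intro h a b m X hX c hc hmm
    exact (h a b hX).2 m c hc hmm
  · intro h a b n X hX
    exact hodgeConjectureFor_of_middleDimension_holds (h a b) hX

/-- **The item modulo `PullbackGlue` and the middle step only**: given `PullbackGlue`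
(stmt-HodgeConjecture-2999; in the tree `limitExtension_pullbackGlue_of_specialisation` derives it from
the specialisation lemma stmt-HodgeConjecture-2998) and the middle-degree form of
stmt-HodgeConjecture-10865 (`MiddleDivisorSupport →` middle Hodge classes are algebraic), `Assembly`
holds — `MiddleDivisorSupportSuffices` from the latter by
`limitExtension_middleDivisorSupportSuffices_iff`. [cite: Thomas2005Nodes, Prop. 2]
[cite: BrosnanFangNiePearlstein2009, §6 Lemma 48] -/
theorem limitExtension_assembly_of_pullbackGlue_of_middle (h₇ : PullbackGlue)
    (h : MiddleDivisorSupport →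
      ∀ ⦃m : ℕ⦄ ⦃X : SchemeOver ℂ⦄, IsSmoothProjective (2 * m) X →
        ∀ c : complexBetti X (2 * m), IsRationalClass c → IsOfHodgeType (2 * m) X (2 * m) m m c →
          c ∈ algebraicClasses X m) : Assembly :=
  limitExtension_assembly_of h₇ (limitExtension_middleDivisorSupportSuffices_iff.2 h)

end Summit.HodgeConjecture.HodgeConjecture.Theorems

end
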